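import Summits.KontsevichZagierPeriods.KontsevichZagierPeriods.Theses.TorsionLogs
import Summits.KontsevichZagierPeriods.KontsevichZagierPeriods.Theorems.TorsionLogsTorsionSectorCompleteReductions
import Summits.KontsevichZagierPeriods.KontsevichZagierPeriods.Theorems.FurushoPentagonSectorToKernelOfLeaves

/-!
# Route KontsevichZagierPeriods/TorsionLogs — split glue of `TorsionSectorComplete` over the route's OWN piece decls

Crux-strategist re-audit r1 of `TorsionSectorComplete` (stmt-KontsevichZagierPeriods-14212), BC2 redirect.  Route rev 10
carries the two pieces as its own items: `TorsionLogs.CubeResolution` (stmt-17978, support — proved in substance: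
`TorsionSectorCompleteStubCubeResolution.stub_cubeResolution`, p171163) and `TorsionLogs.AyoubEffectiveCubeKernel`
(stmt-18116, crux rank 6 — J. Ayoub, Ann. of Math. 181 (2015) Conj. 1.1 at `k = ℚ`).  This file is the glue BY THE
ROUTE'S OWN NAMES, ready for
`ledger route edit route-KontsevichZagierPeriods-TorsionLogs --split TorsionSectorComplete --into children.json --glue-by
Summit.KontsevichZagierPeriods.TorsionLogs.TorsionSectorCompleteOfPieces.TorsionSectorComplete_of_pieces`.
Proof = the landed bridge `kontsevichZagierPeriods_of_cubeResolution_of_ayoubKernel` (Theorems/FurushoPentagonSectorToKernelOfLeaves.lean: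
resolution into the tame span, cube merge, Ayoub admissibility, real Stokes form, semialgebraic primitives, padding +
calibration ⇒ kernel form of Conjecture 1 ⇒ the summit) followed by `TorsionSectorComplete.of_summit`; the same term as
`TorsionSectorCompleteSplit.TorsionSectorComplete_of_subs` (p171043), whose binders are the children verbatim.

-- adapted from Theorems/TorsionLogsTorsionSectorCompleteSplit.lean (`TorsionSectorComplete_of_subs`, this seat)
References: M. Kontsevich, D. Zagier, *Periods* (2001), §1.2, Conjecture 1; J. Ayoub, Ann. of Math. 181 (2015), Conj. 1.1;
J. Ayoub, EMS Newsl. 91 (2014), Rem. 12–13.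
-/

namespace Summit.KontsevichZagierPeriods.TorsionLogs.TorsionSectorCompleteOfPieces

open Summit.KontsevichZagierPeriods.KontsevichZagierPeriods.Theses.TorsionLogs
  (CubeResolution AyoubEffectiveCubeKernel TorsionSectorComplete)

/-- **Split glue by the route's own names**: `CubeResolution → AyoubEffectiveCubeKernel → TorsionSectorComplete`
(route TorsionLogs, items stmt-17978, stmt-18116 ⇒ stmt-14212). [cite: KontsevichZagier2001, §1.2  Conjecture 1] [cite: Ayoub2015, Conj. 1.1] [folklore] -/
theorem TorsionSectorComplete_of_pieces (h₁ : CubeResolution) (h₂ : AyoubEffectiveCubeKernel) :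
    TorsionSectorComplete :=
  Summit.KontsevichZagierPeriods.TorsionLogs.TorsionSectorComplete.of_summit
    (Summit.KontsevichZagierPeriods.FurushoPentagon.SectorToKernel.kontsevichZagierPeriods_of_cubeResolution_of_ayoubKernel
      (fun N u => by
        obtain ⟨c, hc, huc⟩ := h₁ N u
        exact ⟨c, hc, huc⟩)
      h₂)

-- The pieces of this route ARE the hub's route decls `HermiteRigidity.CubeResolution` / `HermiteRigidity.AyoubEffectiveCubeKernel`
-- (items stmt-17978 / stmt-18116): both `Iff.rfl` (identical bodies), checked in the strategist's folder file OfPieces.lean v1.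

end Summit.KontsevichZagierPeriods.TorsionLogs.TorsionSectorCompleteOfPieces
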